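import Summits.BirchSwinnertonDyer.BirchSwinnertonDyer.Theorems.Rank1ResidualJetCarrierEndFormsSwapNoCV
import Summits.BirchSwinnertonDyer.BirchSwinnertonDyer.Theorems.Rank1ResidualJetModPCoreVertexBridgeSwap
import Summits.BirchSwinnertonDyer.BirchSwinnertonDyer.Theorems.Rank1ResidualJetModPThm63LocalFactsV3
import HarnessLib

/-!
# T1 JET road K WITHOUT the `p`-adic tower — part 14: the three carrier END FORMS from level raising, no reading binder
# (width seat `bsd-wall-soed-p2-w2` g5; `--supports`, helper)

Series note (see `Rank1ResidualJetModPCebotarev`, part 1): the road-K end forms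
`JET.jetchevDivisibilityCarrier{Ne,Mult,Add}_of_swapLiterature` (Jetchev 2008 Thm. 1.4 at a bad prime `p ∣ N`,
cell `bsd-jet`) carry the `p`-adic tower binder although every leaf use in their cone is `htower 1`; at `p = 3`
the tower does not follow from `ρ̄₃` onto (Elkies 2006) and the SOED crux of record Ko′ (stmt-24696) is
tower-free. This file re-issues, decl by decl (suffix `_modP`, same namespace, proof text = the original with
`htower 1 ↦ hsurj`, McCallum's Cor. 3.2 / Prop. 4.4 fed by their mod-`p` derivations of parts 1–2), the
following decl(s) of `Rank1ResidualJetCarrierEndFormsSwapNoCV` with `(hsurj : W.HasSurjectiveModNGaloisRep p)` in place of the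
tower. Nothing of `bsd-jet`'s is edited. HONEST FRAMING: theorems only, CONDITIONAL on the displayed hypotheses
(named print: Poitou–Tate for Selmer structures, [GZ86 III (3.1)], Gross 1991 Prop. 3.7 (2) where they occur);
no new definition, no named fact, no `sorry`; BSD is not proved by this file.
References: [cite: Jetchev2008, Thm. 1.4, Thm. 5.2, Prop. 5.3] [cite: McCallumLMS1991, §4 Prop. 4.4, §5].
-/

set_option autoImplicit false

noncomputable section

open scoped Classical Pointwise

open WeierstrassCurve IsDedekindDomain NumberField Field Literature.NumberTheory.EllipticCurves
  Literature.NumberTheory.EllipticCurves.ModularForms Literature.NumberTheory.EllipticCurves.Jetchev2008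
  Literature.NumberTheory.GaloisRepresentations Literature.NumberTheory.GaloisCohomology
  Literature.NumberTheory.GaloisRepresentations.DiscreteGaloisModule
  Summit.BirchSwinnertonDyer.Rank1Residual.X11b Summit.BirchSwinnertonDyer.Rank1Residual.X11b.Three
  Summit.BirchSwinnertonDyer.Rank1Residual.JET.SelmerVocabulary Literature.NumberTheory.Automorphic

namespace Summit.BirchSwinnertonDyer.Rank1Residual.JET

/-- (mod-`p` twin of `jetchevDivisibilityCarrierMult_of_levelRaisingNoCV`: the `p`-adic tower binder replaced by `ρ̄_{E,p}` onto; proof text otherwise that of the original.) **K3 ⟸ LEVEL RAISING (`hR`) + NAMED PRINT, NO reading binder** {[McC] Prop. 4.4, Poitou–Tate,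
[GZ86 III (3.1)] (scoped, guarded)}: Jetchev Thm. 1.4 ∕ Cor. 1.5 read at a multiplicative carrier
`p ∣ N`. Body = pv-2's `jetchevDivisibilityCarrierMult_of_namedPrint` over the K5-free bridge.
[cite: Jetchev2008, Thm. 1.4, Thm. 5.2, Prop. 4.9, Prop. 5.3] [cite: McCallumLMS1991, Prop. 4.4, Prop. 5.2]
[cite: GrossZagier1986, III (3.1)] -/
theorem jetchevDivisibilityCarrierMult_of_levelRaisingNoCV_modP
    (hR : ∀ (W : WeierstrassCurve ℚ) [W.IsElliptic] [W.IsGloballyMinimal] [NeZero (W.conductorNorm ℤ)],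
      ¬ W.HasCM → ∀ (K : Type) [Field K] [NumberField K], IsImaginaryQuadratic K →
      NumberField.discr K ≠ -3 → NumberField.discr K ≠ -4 →
      SatisfiesHeegnerHypothesis (W.conductorNorm ℤ) K →
      ∀ (p : ℕ) [Fact p.Prime], p ≠ 2 → W.HasSurjectiveModNGaloisRep p →
      ∀ (Dt : ModularParametrizationData W (W.conductorNorm ℤ)) (β : ℤ) (ι : K →+* ℂ) (u : ℕ),
      (∀ (c : ℕ), Squarefree c →
        (∀ q ∈ c.primeFactors, Zhang2014.IsKolyvaginPrime (W.conductorNorm ℤ) W K p q ∧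
          1 + u ≤ Zhang2014.kolyvaginIndex W p q) →
        ∀ dc : KolyvaginHeegnerData Dt β ι c,
        ∃ Q : (W.baseChange (ringClassField K ι c)).toAffine.Point,
          ((p ^ u : ℕ) : ℤ) • Q = dc.derivedPoint) →
      ∀ (n₀ : ℕ), Squarefree n₀ →
        (∀ q ∈ n₀.primeFactors, Zhang2014.IsKolyvaginPrime (W.conductorNorm ℤ) W K p q ∧
          1 + u ≤ Zhang2014.kolyvaginIndex W p q) →
        ∀ d₀ : KolyvaginHeegnerData Dt β ι n₀,
        (¬ ∃ Q : (W.baseChange (ringClassField K ι n₀)).toAffine.Point,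
          ((p ^ (u + 1) : ℕ) : ℤ) • Q = d₀.derivedPoint) →
        ∀ m' : ℕ, ∃ (n : ℕ) (d : KolyvaginHeegnerData Dt β ι n), Squarefree n ∧
          (∀ q ∈ n.primeFactors, Zhang2014.IsKolyvaginPrime (W.conductorNorm ℤ) W K p q ∧
            max m' (1 + u) ≤ Zhang2014.kolyvaginIndex W p q) ∧
          ¬ ∃ Q : (W.baseChange (ringClassField K ι n)).toAffine.Point,
            ((p ^ (u + 1) : ℕ) : ℤ) • Q = d.derivedPoint)
    (h372 : GrossLMS1991.prop37_2_frobeniusCongruence)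
    (hPT : ∀ (K : Type) [Field K] [NumberField K], poitouTate_selmerStructure_duality_conj K)
    (hGZ : ∀ (W : WeierstrassCurve ℚ) [W.IsElliptic] [W.IsGloballyMinimal] [NeZero (W.conductorNorm ℤ)]
      (K : Type) [Field K] [NumberField K], IsImaginaryQuadratic K →
      NumberField.discr K ≠ -3 → NumberField.discr K ≠ -4 →
      SatisfiesHeegnerHypothesis (W.conductorNorm ℤ) K →
      ∀ (p : ℕ) [Fact p.Prime], p ≠ 2 → W.HasSurjectiveModNGaloisRep p →
      ∀ (Dt : ModularParametrizationData W (W.conductorNorm ℤ)) (β : ℤ) (ι : K →+* ℂ)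
      [∀ j : ℕ, NumberField (ringClassField K ι j)],
      ∃ n' : ℤ, IsCoprime (p : ℤ) n' ∧ ∀ (m : ℕ), Squarefree m →
        (∀ q ∈ m.primeFactors, Zhang2014.IsKolyvaginPrime (W.conductorNorm ℤ) W K p q) →
        ∀ (dm : KolyvaginHeegnerData Dt β ι m)
        (γ : ringClassField K ι m ≃ₐ[ℚ] ringClassField K ι m), γ ∈ ringClassGal ι m →
        ∀ v : HeightOneSpectrum (𝓞 K), ¬ (W.baseChange K).HasGoodReductionAt v →
          n' • pointsMap (W.baseChange K) (v.adicCompletion K)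
              (dm.toGeomPoints (pointGalHom W (ringClassField K ι m) γ dm.y)) ∈
            E0Receptacle (W.baseChange K) v ∧
          ∀ (ℓ : ℕ), ℓ ∈ m.primeFactors → ∀ (dm' : KolyvaginHeegnerData Dt β ι (m / ℓ))
            (hle : ringClassField K ι (m / ℓ) ≤ ringClassField K ι m),
            n' • pointsMap (W.baseChange K) (v.adicCompletion K)
                (dm.toGeomPoints (pointGalHom W (ringClassField K ι m) γ
                  (WeierstrassCurve.Affine.Point.map (W' := W)
                    ((RingClassField.inclusion ι hle).restrictScalars ℚ) dm'.y))) ∈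
              E0Receptacle (W.baseChange K) v) :
    ∀ (W : WeierstrassCurve ℚ) [W.IsElliptic] [W.IsGloballyMinimal] [NeZero (W.conductorNorm ℤ)],
      ¬ W.HasCM →
      ∀ (K : Type) [Field K] [NumberField K], IsImaginaryQuadratic K →
      NumberField.discr K ≠ -3 → NumberField.discr K ≠ -4 →
      SatisfiesHeegnerHypothesis (W.conductorNorm ℤ) K →
      ∀ (p : ℕ) [Fact p.Prime], p ≠ 2 → W.HasMultiplicativeReductionAtPrime p →
        W.HasSurjectiveModNGaloisRep p →
      ∀ (Dt : ModularParametrizationData W (W.conductorNorm ℤ)) (β : ℤ) (ι : K →+* ℂ)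
        (d₁ : KolyvaginHeegnerData Dt β ι 1), ¬ IsOfFinAddOrder d₁.derivedPoint →
      ∀ (s : ℕ), s ≤ padicValNat p ((W.baseChange ℚ_[p]).localTamagawaNumber ℤ_[p]) →
      ∀ (n : ℕ) (d : KolyvaginHeegnerData Dt β ι n), Squarefree n →
        (∀ ℓ ∈ n.primeFactors, Zhang2014.IsKolyvaginPrime (W.conductorNorm ℤ) W K p ℓ ∧
          s ≤ Zhang2014.kolyvaginIndex W p ℓ) →
        ∃ Q : (W.baseChange (ringClassField K ι n)).toAffine.Point,
          ((p ^ s : ℕ) : ℤ) • Q = d.derivedPoint := by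
  refine jetchevDivisibilityCarrierMult_of_levelRaising_of_namedPrint_H63_modP hR h372 hPT hGZ ?_
  intro W _ _ _ hcm K _ _ hK hD3 hD4 hH τ hτ p _ hp2 hmult hsurj Dt β ι _ d₁ _ mdiv m hmdiv hm mInf
    _ _ k c hk hcore hmc hkM htk hik
  have hp : p.Prime := Fact.out
  -- trivial case: `p ∤ c_p`
  by_cases ht0 : padicValNat p ((W.baseChange ℚ_[p]).localTamagawaNumber ℤ_[p]) = 0
  · rw [ht0]; exact Nat.zero_le _
  have hdvd : p ∣ (W.baseChange ℚ_[p]).localTamagawaNumber ℤ_[p] :=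
    dvd_of_one_le_padicValNat (Nat.one_le_iff_ne_zero.mpr ht0)
  -- the carrier place `v₀ ∣ p`, split, and the transport of the row data
  obtain ⟨v₀, hv₀, hv₀N, hpv₀⟩ := exists_split_carrier_place W K hK τ hτ hH p hmult
  obtain ⟨hminK, hminP, hcEq, hc0, hcyc⟩ := carrierRowData_of_split W K p hK τ v₀ hv₀ hpv₀
  haveI := hminK
  haveI := hminP
  haveI := hcyc (kodairaNeron_isAddCyclic_forall W p p hp2 hdvd)
  -- `τ² = 1`
  haveI : Algebra.IsQuadraticExtension ℚ K := ⟨hK.1⟩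
  have hτ2 : τ * τ = 1 := by
    have hcard : Nat.card (K ≃ₐ[ℚ] K) = 2 := by rw [IsGalois.card_aut_eq_finrank, hK.1]
    obtain ⟨y, -, hyu⟩ := (Nat.card_eq_two_iff' (1 : K ≃ₐ[ℚ] K)).mp hcard
    have h1 : τ = y := hyu τ hτ
    have h2 : τ⁻¹ = y := hyu τ⁻¹ (inv_ne_one.mpr hτ)
    rw [mul_eq_one_iff_eq_inv]
    exact h1.trans h2.symm
  -- instances at level `p^k`
  haveI : NeZero (p ^ k) := ⟨pow_ne_zero k hp.ne_zero⟩
  haveI : Finite (geomTorsion (W.baseChange K) ((p ^ k : ℕ) : ℤ)) :=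
    finite_geomTorsion_of_neZero (W.baseChange K) (p ^ k)
  have hn : ((p ^ k : ℕ) : ℤ) ≠ 0 := by exact_mod_cast pow_ne_zero k hp.ne_zero
  -- the named-print schema [GZ86 III (3.1)] at this frame
  have hρ : W.HasSurjectiveModNGaloisRep p := hsurj
  obtain ⟨n', hcop', hGZ'⟩ := hGZ W K hK hD3 hD4 hH p hp2 hρ Dt β ι
  -- Kolyvagin data of the core vertex
  have hkc : (k : ℕ∞) ≤ Zhang2014.levelIndex W p c.1 := le_trans le_self_add hkM
  have hcK : ∀ ℓ ∈ c.1.primeFactors, Zhang2014.IsKolyvaginPrime (W.conductorNorm ℤ) W K p ℓ ∧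
      k ≤ Zhang2014.kolyvaginIndex W p ℓ := fun ℓ hℓ ↦
    ⟨c.2.2 ℓ hℓ, Zhang2014.natCast_le_levelIndex_iff.mp hkc ℓ hℓ⟩
  -- the exponent
  have hfac : (((W.baseChange K).baseChange (v₀.adicCompletion K)).localTamagawaNumber
      (v₀.adicCompletionIntegers K)).factorization p =
      padicValNat p ((W.baseChange ℚ_[p]).localTamagawaNumber ℤ_[p]) := by
    rw [hcEq, Nat.factorization_def _ hp]
  have htk' : (((W.baseChange K).baseChange (v₀.adicCompletion K)).localTamagawaNumber
      (v₀.adicCompletionIntegers K)).factorization p < k := by rw [hfac]; exact htk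
  -- the H63 line «v3» with `h49str` (Jetchev Prop. 4.9 proper at the carrier pair) FED BY NAME (pv-1 g7)
  have key := tamagawaExponent_le_mInfty_of_localFactsPrime_v3_modP h372 W hcm K hK hD3 hD4 hH (hPT K) p hp2
    hsurj Dt β ι τ hτ hτ2 hcop' hGZ' mdiv m hmdiv hm k hn c hk hcore mInf hmc hkM hik v₀ hv₀ hv₀N hc0 htk'
    (fun ℓ h1 h2 h3 d' q hq ↦ localization_kolyvaginClass_mem_stringentFamily_carrier_kolyvagin W K hK hD3
      hD4 hH hp2 hρ Dt β ι hcop' hGZ' τ hn c.2.1 hcK v₀ hv₀N ℓ h1 h2 h3 d' q hq)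
  rw [hfac] at key
  exact key

/-- (mod-`p` twin of `jetchevDivisibilityCarrierNe_of_levelRaisingNoCV`: the `p`-adic tower binder replaced by `ρ̄_{E,p}` onto; proof text otherwise that of the original.) **K1 ⟸ NAMED PRINT ONLY, NO reading binder** (carrier a prime `q ∣ N`, `q ≠ p`).
[cite: Jetchev2008, Thm. 1.4, Thm. 5.2, Prop. 4.9, Prop. 5.3] [cite: McCallumLMS1991, Prop. 4.4, Prop. 5.2]
[cite: GrossZagier1986, III (3.1)] -/
theorem jetchevDivisibilityCarrierNe_of_levelRaisingNoCV_modP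
    (hR : ∀ (W : WeierstrassCurve ℚ) [W.IsElliptic] [W.IsGloballyMinimal] [NeZero (W.conductorNorm ℤ)],
      ¬ W.HasCM → ∀ (K : Type) [Field K] [NumberField K], IsImaginaryQuadratic K →
      NumberField.discr K ≠ -3 → NumberField.discr K ≠ -4 →
      SatisfiesHeegnerHypothesis (W.conductorNorm ℤ) K →
      ∀ (p : ℕ) [Fact p.Prime], p ≠ 2 → W.HasSurjectiveModNGaloisRep p →
      ∀ (Dt : ModularParametrizationData W (W.conductorNorm ℤ)) (β : ℤ) (ι : K →+* ℂ) (u : ℕ),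
      (∀ (c : ℕ), Squarefree c →
        (∀ q ∈ c.primeFactors, Zhang2014.IsKolyvaginPrime (W.conductorNorm ℤ) W K p q ∧
          1 + u ≤ Zhang2014.kolyvaginIndex W p q) →
        ∀ dc : KolyvaginHeegnerData Dt β ι c,
        ∃ Q : (W.baseChange (ringClassField K ι c)).toAffine.Point,
          ((p ^ u : ℕ) : ℤ) • Q = dc.derivedPoint) →
      ∀ (n₀ : ℕ), Squarefree n₀ →
        (∀ q ∈ n₀.primeFactors, Zhang2014.IsKolyvaginPrime (W.conductorNorm ℤ) W K p q ∧
          1 + u ≤ Zhang2014.kolyvaginIndex W p q) →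
        ∀ d₀ : KolyvaginHeegnerData Dt β ι n₀,
        (¬ ∃ Q : (W.baseChange (ringClassField K ι n₀)).toAffine.Point,
          ((p ^ (u + 1) : ℕ) : ℤ) • Q = d₀.derivedPoint) →
        ∀ m' : ℕ, ∃ (n : ℕ) (d : KolyvaginHeegnerData Dt β ι n), Squarefree n ∧
          (∀ q ∈ n.primeFactors, Zhang2014.IsKolyvaginPrime (W.conductorNorm ℤ) W K p q ∧
            max m' (1 + u) ≤ Zhang2014.kolyvaginIndex W p q) ∧
          ¬ ∃ Q : (W.baseChange (ringClassField K ι n)).toAffine.Point,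
            ((p ^ (u + 1) : ℕ) : ℤ) • Q = d.derivedPoint)
    (h372 : GrossLMS1991.prop37_2_frobeniusCongruence)
    (hPT : ∀ (K : Type) [Field K] [NumberField K], poitouTate_selmerStructure_duality_conj K)
    (hGZ : ∀ (W : WeierstrassCurve ℚ) [W.IsElliptic] [W.IsGloballyMinimal] [NeZero (W.conductorNorm ℤ)]
      (K : Type) [Field K] [NumberField K], IsImaginaryQuadratic K →
      NumberField.discr K ≠ -3 → NumberField.discr K ≠ -4 →
      SatisfiesHeegnerHypothesis (W.conductorNorm ℤ) K →
      ∀ (p : ℕ) [Fact p.Prime], p ≠ 2 → W.HasSurjectiveModNGaloisRep p →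
      ∀ (Dt : ModularParametrizationData W (W.conductorNorm ℤ)) (β : ℤ) (ι : K →+* ℂ)
      [∀ j : ℕ, NumberField (ringClassField K ι j)],
      ∃ n' : ℤ, IsCoprime (p : ℤ) n' ∧ ∀ (m : ℕ), Squarefree m →
        (∀ q ∈ m.primeFactors, Zhang2014.IsKolyvaginPrime (W.conductorNorm ℤ) W K p q) →
        ∀ (dm : KolyvaginHeegnerData Dt β ι m)
        (γ : ringClassField K ι m ≃ₐ[ℚ] ringClassField K ι m), γ ∈ ringClassGal ι m →
        ∀ v : HeightOneSpectrum (𝓞 K), ¬ (W.baseChange K).HasGoodReductionAt v →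
          n' • pointsMap (W.baseChange K) (v.adicCompletion K)
              (dm.toGeomPoints (pointGalHom W (ringClassField K ι m) γ dm.y)) ∈
            E0Receptacle (W.baseChange K) v ∧
          ∀ (ℓ : ℕ), ℓ ∈ m.primeFactors → ∀ (dm' : KolyvaginHeegnerData Dt β ι (m / ℓ))
            (hle : ringClassField K ι (m / ℓ) ≤ ringClassField K ι m),
            n' • pointsMap (W.baseChange K) (v.adicCompletion K)
                (dm.toGeomPoints (pointGalHom W (ringClassField K ι m) γ
                  (WeierstrassCurve.Affine.Point.map (W' := W)
                    ((RingClassField.inclusion ι hle).restrictScalars ℚ) dm'.y))) ∈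
              E0Receptacle (W.baseChange K) v) :
    ∀ (W : WeierstrassCurve ℚ) [W.IsElliptic] [W.IsGloballyMinimal] [NeZero (W.conductorNorm ℤ)],
      ¬ W.HasCM →
      ∀ (K : Type) [Field K] [NumberField K], IsImaginaryQuadratic K →
      NumberField.discr K ≠ -3 → NumberField.discr K ≠ -4 →
      SatisfiesHeegnerHypothesis (W.conductorNorm ℤ) K →
      ∀ (p : ℕ) [Fact p.Prime], p ≠ 2 → W.HasSurjectiveModNGaloisRep p →
      ∀ (Dt : ModularParametrizationData W (W.conductorNorm ℤ)) (β : ℤ) (ι : K →+* ℂ)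
        (d₁ : KolyvaginHeegnerData Dt β ι 1), ¬ IsOfFinAddOrder d₁.derivedPoint →
      ∀ (q : ℕ) [Fact q.Prime], q ∣ W.conductorNorm ℤ → q ≠ p →
      ∀ (s : ℕ), s ≤ padicValNat p ((W.baseChange ℚ_[q]).localTamagawaNumber ℤ_[q]) →
      ∀ (n : ℕ) (d : KolyvaginHeegnerData Dt β ι n), Squarefree n →
        (∀ ℓ ∈ n.primeFactors, Zhang2014.IsKolyvaginPrime (W.conductorNorm ℤ) W K p ℓ ∧
          s ≤ Zhang2014.kolyvaginIndex W p ℓ) →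
        ∃ Q : (W.baseChange (ringClassField K ι n)).toAffine.Point,
          ((p ^ s : ℕ) : ℤ) • Q = d.derivedPoint := by
  refine jetchevDivisibilityCarrierNe_of_levelRaising_of_namedPrint_H63_modP hR h372 hPT hGZ ?_
  intro W _ _ _ hcm K _ _ hK hD3 hD4 hH τ hτ p _ hp2 hsurj Dt β ι _ d₁ _ q _ hqN _ mdiv m hmdiv hm mInf
    _ _ k c hk hcore hmc hkM htk hik
  have hp : p.Prime := Fact.out
  -- trivial case: `p ∤ c_q`
  by_cases ht0 : padicValNat p ((W.baseChange ℚ_[q]).localTamagawaNumber ℤ_[q]) = 0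
  · rw [ht0]; exact Nat.zero_le _
  have hdvd : p ∣ (W.baseChange ℚ_[q]).localTamagawaNumber ℤ_[q] :=
    dvd_of_one_le_padicValNat (Nat.one_le_iff_ne_zero.mpr ht0)
  -- the carrier place `v₀ ∣ q`, split, and the transport of the row data
  obtain ⟨v₀, hv₀, hv₀N, hqv₀⟩ := exists_split_place_of_dvd K hK τ hτ hH q hqN
  obtain ⟨hminK, hminP, hcEq, hc0, hcyc⟩ := carrierRowData_of_split W K q hK τ v₀ hv₀ hqv₀
  haveI := hminK
  haveI := hminP
  haveI := hcyc (kodairaNeron_isAddCyclic_forall W q p hp2 hdvd)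
  -- `τ² = 1`
  haveI : Algebra.IsQuadraticExtension ℚ K := ⟨hK.1⟩
  have hτ2 : τ * τ = 1 := by
    have hcard : Nat.card (K ≃ₐ[ℚ] K) = 2 := by rw [IsGalois.card_aut_eq_finrank, hK.1]
    obtain ⟨y, -, hyu⟩ := (Nat.card_eq_two_iff' (1 : K ≃ₐ[ℚ] K)).mp hcard
    have h1 : τ = y := hyu τ hτ
    have h2 : τ⁻¹ = y := hyu τ⁻¹ (inv_ne_one.mpr hτ)
    rw [mul_eq_one_iff_eq_inv]
    exact h1.trans h2.symm
  -- instances at level `p^k`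
  haveI : NeZero (p ^ k) := ⟨pow_ne_zero k hp.ne_zero⟩
  haveI : Finite (geomTorsion (W.baseChange K) ((p ^ k : ℕ) : ℤ)) :=
    finite_geomTorsion_of_neZero (W.baseChange K) (p ^ k)
  have hn : ((p ^ k : ℕ) : ℤ) ≠ 0 := by exact_mod_cast pow_ne_zero k hp.ne_zero
  -- the named-print schema [GZ86 III (3.1)] at this frame
  have hρ : W.HasSurjectiveModNGaloisRep p := hsurj
  obtain ⟨n', hcop', hGZ'⟩ := hGZ W K hK hD3 hD4 hH p hp2 hρ Dt β ι
  -- Kolyvagin data of the core vertex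
  have hkc : (k : ℕ∞) ≤ Zhang2014.levelIndex W p c.1 := le_trans le_self_add hkM
  have hcK : ∀ ℓ ∈ c.1.primeFactors, Zhang2014.IsKolyvaginPrime (W.conductorNorm ℤ) W K p ℓ ∧
      k ≤ Zhang2014.kolyvaginIndex W p ℓ := fun ℓ hℓ ↦
    ⟨c.2.2 ℓ hℓ, Zhang2014.natCast_le_levelIndex_iff.mp hkc ℓ hℓ⟩
  -- the exponent
  have hfac : (((W.baseChange K).baseChange (v₀.adicCompletion K)).localTamagawaNumber
      (v₀.adicCompletionIntegers K)).factorization p =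
      padicValNat p ((W.baseChange ℚ_[q]).localTamagawaNumber ℤ_[q]) := by
    rw [hcEq, Nat.factorization_def _ hp]
  have htk' : (((W.baseChange K).baseChange (v₀.adicCompletion K)).localTamagawaNumber
      (v₀.adicCompletionIntegers K)).factorization p < k := by rw [hfac]; exact htk
  -- the H63 line «v3» with `h49str` (Jetchev Prop. 4.9 proper at the carrier pair) FED BY NAME (pv-1 g7)
  have key := tamagawaExponent_le_mInfty_of_localFactsPrime_v3_modP h372 W hcm K hK hD3 hD4 hH (hPT K) p hp2
    hsurj Dt β ι τ hτ hτ2 hcop' hGZ' mdiv m hmdiv hm k hn c hk hcore mInf hmc hkM hik v₀ hv₀ hv₀N hc0 htk'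
    (fun ℓ h1 h2 h3 d' q hq ↦ localization_kolyvaginClass_mem_stringentFamily_carrier_kolyvagin W K hK hD3
      hD4 hH hp2 hρ Dt β ι hcop' hGZ' τ hn c.2.1 hcK v₀ hv₀N ℓ h1 h2 h3 d' q hq)
  rw [hfac] at key
  exact key

/-- (mod-`p` twin of `jetchevDivisibilityCarrierAdd_of_levelRaisingNoCV`: the `p`-adic tower binder replaced by `ρ̄_{E,p}` onto; proof text otherwise that of the original.) **K4 ⟸ NAMED PRINT ONLY, NO reading binder** (carrier `p`, `E` additive at `p`).
[cite: Jetchev2008, Thm. 1.4, Thm. 5.2, Prop. 4.9, Prop. 5.3] [cite: McCallumLMS1991, Prop. 4.4, Prop. 5.2]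
[cite: GrossZagier1986, III (3.1)] -/
theorem jetchevDivisibilityCarrierAdd_of_levelRaisingNoCV_modP
    (hR : ∀ (W : WeierstrassCurve ℚ) [W.IsElliptic] [W.IsGloballyMinimal] [NeZero (W.conductorNorm ℤ)],
      ¬ W.HasCM → ∀ (K : Type) [Field K] [NumberField K], IsImaginaryQuadratic K →
      NumberField.discr K ≠ -3 → NumberField.discr K ≠ -4 →
      SatisfiesHeegnerHypothesis (W.conductorNorm ℤ) K →
      ∀ (p : ℕ) [Fact p.Prime], p ≠ 2 → W.HasSurjectiveModNGaloisRep p →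
      ∀ (Dt : ModularParametrizationData W (W.conductorNorm ℤ)) (β : ℤ) (ι : K →+* ℂ) (u : ℕ),
      (∀ (c : ℕ), Squarefree c →
        (∀ q ∈ c.primeFactors, Zhang2014.IsKolyvaginPrime (W.conductorNorm ℤ) W K p q ∧
          1 + u ≤ Zhang2014.kolyvaginIndex W p q) →
        ∀ dc : KolyvaginHeegnerData Dt β ι c,
        ∃ Q : (W.baseChange (ringClassField K ι c)).toAffine.Point,
          ((p ^ u : ℕ) : ℤ) • Q = dc.derivedPoint) →
      ∀ (n₀ : ℕ), Squarefree n₀ →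
        (∀ q ∈ n₀.primeFactors, Zhang2014.IsKolyvaginPrime (W.conductorNorm ℤ) W K p q ∧
          1 + u ≤ Zhang2014.kolyvaginIndex W p q) →
        ∀ d₀ : KolyvaginHeegnerData Dt β ι n₀,
        (¬ ∃ Q : (W.baseChange (ringClassField K ι n₀)).toAffine.Point,
          ((p ^ (u + 1) : ℕ) : ℤ) • Q = d₀.derivedPoint) →
        ∀ m' : ℕ, ∃ (n : ℕ) (d : KolyvaginHeegnerData Dt β ι n), Squarefree n ∧
          (∀ q ∈ n.primeFactors, Zhang2014.IsKolyvaginPrime (W.conductorNorm ℤ) W K p q ∧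
            max m' (1 + u) ≤ Zhang2014.kolyvaginIndex W p q) ∧
          ¬ ∃ Q : (W.baseChange (ringClassField K ι n)).toAffine.Point,
            ((p ^ (u + 1) : ℕ) : ℤ) • Q = d.derivedPoint)
    (h372 : GrossLMS1991.prop37_2_frobeniusCongruence)
    (hPT : ∀ (K : Type) [Field K] [NumberField K], poitouTate_selmerStructure_duality_conj K)
    (hGZ : ∀ (W : WeierstrassCurve ℚ) [W.IsElliptic] [W.IsGloballyMinimal] [NeZero (W.conductorNorm ℤ)]
      (K : Type) [Field K] [NumberField K], IsImaginaryQuadratic K →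
      NumberField.discr K ≠ -3 → NumberField.discr K ≠ -4 →
      SatisfiesHeegnerHypothesis (W.conductorNorm ℤ) K →
      ∀ (p : ℕ) [Fact p.Prime], p ≠ 2 → W.HasSurjectiveModNGaloisRep p →
      ∀ (Dt : ModularParametrizationData W (W.conductorNorm ℤ)) (β : ℤ) (ι : K →+* ℂ)
      [∀ j : ℕ, NumberField (ringClassField K ι j)],
      ∃ n' : ℤ, IsCoprime (p : ℤ) n' ∧ ∀ (m : ℕ), Squarefree m →
        (∀ q ∈ m.primeFactors, Zhang2014.IsKolyvaginPrime (W.conductorNorm ℤ) W K p q) →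
        ∀ (dm : KolyvaginHeegnerData Dt β ι m)
        (γ : ringClassField K ι m ≃ₐ[ℚ] ringClassField K ι m), γ ∈ ringClassGal ι m →
        ∀ v : HeightOneSpectrum (𝓞 K), ¬ (W.baseChange K).HasGoodReductionAt v →
          n' • pointsMap (W.baseChange K) (v.adicCompletion K)
              (dm.toGeomPoints (pointGalHom W (ringClassField K ι m) γ dm.y)) ∈
            E0Receptacle (W.baseChange K) v ∧
          ∀ (ℓ : ℕ), ℓ ∈ m.primeFactors → ∀ (dm' : KolyvaginHeegnerData Dt β ι (m / ℓ))
            (hle : ringClassField K ι (m / ℓ) ≤ ringClassField K ι m),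
            n' • pointsMap (W.baseChange K) (v.adicCompletion K)
                (dm.toGeomPoints (pointGalHom W (ringClassField K ι m) γ
                  (WeierstrassCurve.Affine.Point.map (W' := W)
                    ((RingClassField.inclusion ι hle).restrictScalars ℚ) dm'.y))) ∈
              E0Receptacle (W.baseChange K) v) :
    ∀ (W : WeierstrassCurve ℚ) [W.IsElliptic] [W.IsGloballyMinimal] [NeZero (W.conductorNorm ℤ)],
      ¬ W.HasCM →
      ∀ (K : Type) [Field K] [NumberField K], IsImaginaryQuadratic K →
      NumberField.discr K ≠ -3 → NumberField.discr K ≠ -4 →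
      SatisfiesHeegnerHypothesis (W.conductorNorm ℤ) K →
      ∀ (p : ℕ) [Fact p.Prime], p ≠ 2 →
        ¬ W.HasGoodReductionAtPrime p → ¬ W.HasMultiplicativeReductionAtPrime p →
        W.HasSurjectiveModNGaloisRep p →
      ∀ (Dt : ModularParametrizationData W (W.conductorNorm ℤ)) (β : ℤ) (ι : K →+* ℂ)
        (d₁ : KolyvaginHeegnerData Dt β ι 1), ¬ IsOfFinAddOrder d₁.derivedPoint →
      ∀ (s : ℕ), s ≤ padicValNat p ((W.baseChange ℚ_[p]).localTamagawaNumber ℤ_[p]) →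
      ∀ (n : ℕ) (d : KolyvaginHeegnerData Dt β ι n), Squarefree n →
        (∀ ℓ ∈ n.primeFactors, Zhang2014.IsKolyvaginPrime (W.conductorNorm ℤ) W K p ℓ ∧
          s ≤ Zhang2014.kolyvaginIndex W p ℓ) →
        ∃ Q : (W.baseChange (ringClassField K ι n)).toAffine.Point,
          ((p ^ s : ℕ) : ℤ) • Q = d.derivedPoint := by
  refine jetchevDivisibilityCarrierAdd_of_levelRaising_of_namedPrint_H63_modP hR h372 hPT hGZ ?_
  intro W _ _ _ hcm K _ _ hK hD3 hD4 hH τ hτ p _ hp2 hngood _ hsurj Dt β ι _ d₁ _ mdiv m hmdiv hm mInf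
    _ _ k c hk hcore hmc hkM htk hik
  have hp : p.Prime := Fact.out
  -- trivial case: `p ∤ c_p`
  by_cases ht0 : padicValNat p ((W.baseChange ℚ_[p]).localTamagawaNumber ℤ_[p]) = 0
  · rw [ht0]; exact Nat.zero_le _
  have hdvd : p ∣ (W.baseChange ℚ_[p]).localTamagawaNumber ℤ_[p] :=
    dvd_of_one_le_padicValNat (Nat.one_le_iff_ne_zero.mpr ht0)
  -- the carrier place `v₀ ∣ p` (`p ∣ N`: bad reduction), split, and the transport of the row data
  have hpN : p ∣ W.conductorNorm ℤ := (W.dvd_conductorNorm_iff_not_hasGoodReductionAtPrime p).mpr hngood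
  obtain ⟨v₀, hv₀, hv₀N, hpv₀⟩ := exists_split_place_of_dvd K hK τ hτ hH p hpN
  obtain ⟨hminK, hminP, hcEq, hc0, hcyc⟩ := carrierRowData_of_split W K p hK τ v₀ hv₀ hpv₀
  haveI := hminK
  haveI := hminP
  haveI := hcyc (kodairaNeron_isAddCyclic_forall W p p hp2 hdvd)
  -- `τ² = 1`
  haveI : Algebra.IsQuadraticExtension ℚ K := ⟨hK.1⟩
  have hτ2 : τ * τ = 1 := by
    have hcard : Nat.card (K ≃ₐ[ℚ] K) = 2 := by rw [IsGalois.card_aut_eq_finrank, hK.1]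
    obtain ⟨y, -, hyu⟩ := (Nat.card_eq_two_iff' (1 : K ≃ₐ[ℚ] K)).mp hcard
    have h1 : τ = y := hyu τ hτ
    have h2 : τ⁻¹ = y := hyu τ⁻¹ (inv_ne_one.mpr hτ)
    rw [mul_eq_one_iff_eq_inv]
    exact h1.trans h2.symm
  -- instances at level `p^k`
  haveI : NeZero (p ^ k) := ⟨pow_ne_zero k hp.ne_zero⟩
  haveI : Finite (geomTorsion (W.baseChange K) ((p ^ k : ℕ) : ℤ)) :=
    finite_geomTorsion_of_neZero (W.baseChange K) (p ^ k)
  have hn : ((p ^ k : ℕ) : ℤ) ≠ 0 := by exact_mod_cast pow_ne_zero k hp.ne_zero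
  -- the named-print schema [GZ86 III (3.1)] at this frame
  have hρ : W.HasSurjectiveModNGaloisRep p := hsurj
  obtain ⟨n', hcop', hGZ'⟩ := hGZ W K hK hD3 hD4 hH p hp2 hρ Dt β ι
  -- Kolyvagin data of the core vertex
  have hkc : (k : ℕ∞) ≤ Zhang2014.levelIndex W p c.1 := le_trans le_self_add hkM
  have hcK : ∀ ℓ ∈ c.1.primeFactors, Zhang2014.IsKolyvaginPrime (W.conductorNorm ℤ) W K p ℓ ∧
      k ≤ Zhang2014.kolyvaginIndex W p ℓ := fun ℓ hℓ ↦
    ⟨c.2.2 ℓ hℓ, Zhang2014.natCast_le_levelIndex_iff.mp hkc ℓ hℓ⟩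
  -- the exponent
  have hfac : (((W.baseChange K).baseChange (v₀.adicCompletion K)).localTamagawaNumber
      (v₀.adicCompletionIntegers K)).factorization p =
      padicValNat p ((W.baseChange ℚ_[p]).localTamagawaNumber ℤ_[p]) := by
    rw [hcEq, Nat.factorization_def _ hp]
  have htk' : (((W.baseChange K).baseChange (v₀.adicCompletion K)).localTamagawaNumber
      (v₀.adicCompletionIntegers K)).factorization p < k := by rw [hfac]; exact htk
  -- the H63 line «v3» with `h49str` (Jetchev Prop. 4.9 proper at the carrier pair) FED BY NAME (pv-1 g7)
  have key := tamagawaExponent_le_mInfty_of_localFactsPrime_v3_modP h372 W hcm K hK hD3 hD4 hH (hPT K) p hp2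
    hsurj Dt β ι τ hτ hτ2 hcop' hGZ' mdiv m hmdiv hm k hn c hk hcore mInf hmc hkM hik v₀ hv₀ hv₀N hc0 htk'
    (fun ℓ h1 h2 h3 d' q hq ↦ localization_kolyvaginClass_mem_stringentFamily_carrier_kolyvagin W K hK hD3
      hD4 hH hp2 hρ Dt β ι hcop' hGZ' τ hn c.2.1 hcK v₀ hv₀N ℓ h1 h2 h3 d' q hq)
  rw [hfac] at key
  exact key

end Summit.BirchSwinnertonDyer.Rank1Residual.JET

end
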